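import Summits.BirchSwinnertonDyer.BirchSwinnertonDyer.Theorems.KolyvaginRoadThreeZhangFrameHLNonsplitOfSchneider
import HarnessLib

/-!
# Route `KolyvaginRoadThree`, crux `ZhangSharpFrameAtThreeHL` (item stmt-BirchSwinnertonDyer-19574), stub `stub_zhangFrameHL_nonsplit`:
# the MINIMAL open input of the non-split half — Schneider's non-degeneracy at 3 on A1 ∩ non-split ONLY — and the bookkeeping
# `SchneiderAtThree ⟺ SchneiderTamAtThree ∧ (Schneider on A1 ∩ non-split)`
# (cell `bsd-stepL`, seat `bsd-stepL-koly3b` (PART 1b ACCEL seat (10)); `--supports stmt-BirchSwinnertonDyer-19574`, helper; companion of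
# `KolyvaginRoadThreeZhangFrameHLNonsplitOfSchneider.lean`, p456367)

HONEST FRAMING. BSD, Kolyvagin's conjecture mod 3 and Schneider's conjecture are asserted nowhere; THEOREMS ONLY (0 definitions, 0 named
facts, 0 `sorry`); every published input is a named fact taken as a binder. PARTITION: O2@3 (B10) × A1 ∩ NON-SPLIT(3) — types-the-object-of;
closes: none.

WHAT. p456367's `Theorems.stub_zhangFrameHL_nonsplit_of_schneiderAtThree` takes `ClassRecordThree.SchneiderAtThree` (item 19106), which
asks `Reg₃(E) ≠ 0` on ALL non-split (ram) X11b@3 curves — including the Tamagawa cells `3 ∣ ∏c`, where the Kolyvagin road already has its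
own crux `SchneiderTamAtThree` (item 19154) and where every mod-3 Kolyvagin class VANISHES (LEMMA V, `KolyvaginRoadThreeTamagawaVanishing`).
The registered non-split stub lives on A1 (`3 ∤ ∏c`) and needs the hypothesis only THERE:

* `stub_zhangFrameHL_nonsplit_of_regulatorNonvanishing_onA1` — the registered stub signature VERBATIM from the published inputs and
  `∀ W, ClassX11b W 3 → Ram W 3 → ¬ split(3) → ¬ 3 ∣ ∏c → ClassClosure.RegulatorNonvanishingAt W 3` (the shape a by-name support item
  «Schneider at 3 on A1 ∩ non-split» would have; reg3-eng's REG3CERT kernel rows certify it on 626 of the 646 TRUE-OPEN classes);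
* `schneiderAtThree_iff_tam_and_onA1` — `SchneiderAtThree ↔ SchneiderTamAtThree ∧ (the A1 ∩ non-split restriction)` (case split on
  `3 ∣ ∏c`), so a re-keyed Kolyvagin road consuming 19154 + the restriction consumes exactly 19106.

References (locators only): [cite: Skinner2016PacificMC, Thm. A (§1), §3.2] [cite: SteinWuthrich2013, Thm. 6.1 and §4.2]
[cite: Disegni2020, Thm. 1] [cite: McCallumLMS1991, §5 Cor. 5.6] [cite: WZhang2014, Remark 5 and Thm. 10.2].
-/

noncomputable section

open scoped Classical

namespace Summit.BirchSwinnertonDyer.BirchSwinnertonDyer.Theorems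

open WeierstrassCurve NumberField Literature.NumberTheory.EllipticCurves
  Literature.NumberTheory.EllipticCurves.ModularForms
  Literature.NumberTheory.EllipticCurves.Rank1Residual
  Literature.NumberTheory.EllipticCurves.Skinner2016
  Literature.NumberTheory.EllipticCurves.SteinWuthrich2013
  Literature.NumberTheory.EllipticCurves.Disegni2020
  Summit.BirchSwinnertonDyer.Rank1Residual Summit.BirchSwinnertonDyer.Rank1Residual.X11b

/-- **The registered stub `stub_zhangFrameHL_nonsplit` from the published inputs and Schneider's non-degeneracy at 3 ON THE
STUB'S OWN LOCUS ONLY** (A1 ∩ non-split: `ClassX11b W 3`, a (ram) prime, NON-split at 3, `3 ∤ ∏ c_ℓ`) — the minimal-hypothesis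
form of `stub_zhangFrameHL_nonsplit_of_schneiderAtThree`: `ClassRecordThree.SchneiderAtThree` (item 19106) asks `Reg₃ ≠ 0` also
on the Tamagawa cells `3 ∣ ∏c` (where the Kolyvagin road's own crux `SchneiderTamAtThree`, item 19154, lives and where every mod-3
class VANISHES — LEMMA V); the non-split stub needs it only off them. This is the exact shape a by-name support item «Schneider at 3
on A1 ∩ non-split» would have (19106 = it ∪ 19154). On this locus reg3-eng's REG3CERT kernel rows certify the hypothesis curve
by curve (626 of the 646 TRUE-OPEN classes at the time of writing). CONDITIONAL on every binder; nothing is booked.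
[cite: Skinner2016PacificMC, Thm. A (§1), §3.2] [cite: SteinWuthrich2013, Thm. 6.1 and §4.2] [cite: Disegni2020, Thm. 1]
[cite: McCallumLMS1991, §5 Cor. 5.6] [cite: WZhang2014, Remark 5 and Thm. 10.2] -/
theorem stub_zhangFrameHL_nonsplit_of_regulatorNonvanishing_onA1
    (hGZ : ∀ (N : ℕ) [NeZero N] (W : WeierstrassCurve ℚ) (K : Type) [Field K] [NumberField K],
      gross_zagier N W K)
    (hKo : ∀ (N : ℕ) [NeZero N] (W : WeierstrassCurve ℚ) (K : Type) [Field K] [NumberField K],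
      kolyvagin N W K)
    (hSk : thmC_padicValRat_bsd_rank_zero)
    (hGZK : rank_eq_analyticRank_of_analyticRank_le_one) (hmod : hasEntireLFunction_rat)
    (hrec : ∀ (N : ℕ) [NeZero N] (W : WeierstrassCurve ℚ) (K : Type) [Field K] [NumberField K],
      heegnerPointOfConductor_one_galoisConj N W K)
    (h1 : ∀ (N : ℕ) [NeZero N] (W : WeierstrassCurve ℚ) (K : Type) [Field K] [NumberField K],
      phi_heegnerPointOfConductor_mem_range_map_ringClassField N W K)
    (h2 : ∀ (K : Type) [Field K] [NumberField K], exists_generator_ringClassGalOver K)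
    (hMcU : McCallum1991_padicValNat_card_sha_primary_add_le_of_globalDivisibility)
    (hSkA : thmA_charIdeal_multiplicative) (hJn : thm61_nonsplitMultiplicative) (hHn : exists_isMultCanonical)
    (hD : thm1_padicBSD_rankOne_multiplicative) (hpar : nonempty_modularParametrizationData)
    -- THE OPEN INPUT, on A1 ∩ non-split only
    (hRegA1 : ∀ (W : WeierstrassCurve ℚ) [W.IsElliptic] [W.IsGloballyMinimal],
      Summit.BirchSwinnertonDyer.Rank1Residual.ClassX11b W 3 → Literature.NumberTheory.EllipticCurves.Rank1Residual.Ram W 3 →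
        ¬ W.HasSplitMultiplicativeReductionAtPrime 3 → ¬ 3 ∣ W.tamagawaProduct →
        ClassClosure.RegulatorNonvanishingAt W 3) :
    ∀ (W : WeierstrassCurve ℚ) [W.IsElliptic] [W.IsGloballyMinimal] [NeZero (W.conductorNorm ℤ)] (K : Type)
      [Field K] [NumberField K]
      (Dt : Literature.NumberTheory.EllipticCurves.ModularForms.ModularParametrizationData W (W.conductorNorm ℤ))
      (β : ℤ) (ι : K →+* ℂ), Summit.BirchSwinnertonDyer.Rank1Residual.ClassX11b W 3 →
      W.HasMultiplicativeReductionAtPrime 3 → ¬ W.HasSplitMultiplicativeReductionAtPrime 3 →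
      Literature.NumberTheory.EllipticCurves.Rank1Residual.Surj W 3 →
      Literature.NumberTheory.EllipticCurves.Rank1Residual.Ram W 3 → ¬ 3 ∣ W.tamagawaProduct →
      Literature.NumberTheory.EllipticCurves.IsImaginaryQuadratic K → Odd (NumberField.discr K) →
      Literature.NumberTheory.EllipticCurves.SatisfiesHeegnerHypothesis (W.conductorNorm ℤ) K →
      (W.quadraticTwist (NumberField.discr K : ℚ)).entireLFunction 1 ≠ 0 → NumberField.discr K ≠ -3 →
      (4 * (W.conductorNorm ℤ : ℤ)) ∣ β ^ 2 - NumberField.discr K → ¬ (3 : ℤ) ∣ Dt.c →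
      ∃ (n : ℕ) (d : Literature.NumberTheory.EllipticCurves.KolyvaginHeegnerData Dt β ι n),
        Literature.NumberTheory.EllipticCurves.KolyvaginDescent.KolSupp
            (Literature.NumberTheory.EllipticCurves.Zhang2014.IsKolyvaginPrime (W.conductorNorm ℤ) W K 3) n ∧
          d.kolyvaginClass Nat.prime_three 1 ≠ 0 := by
  intro W _ _ _ K _ _ Dt β ι hX _hmult hns _hsurj hram htam hK hodd hH hLt _h3 hβ hc
  exact Summit.BirchSwinnertonDyer.Rank1Residual.X11b.Three.Koly.kolyvaginClass_one_ne_zero_at_hlFrame_of_nonsplit_of_regulatorNonvanishingAt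
    W K Dt β ι (hGZ _ W K) (hKo _ W K) hSk hGZK hmod (hrec _ W K) (h1 _ W K) (h2 K) hMcU hSkA hJn hHn hD hpar
    hX hns hram htam hK hodd hH hLt hβ hc (hRegA1 W hX hram hns htam)

/-- **`SchneiderAtThree` = (Schneider on A1 ∩ non-split) ∪ `SchneiderTamAtThree`** — bookkeeping for the re-key option: the K2@3
crux (item 19106) is equivalent to the conjunction of the Kolyvagin road's own Tamagawa-cell crux `SchneiderTamAtThree` (item 19154)
and the A1 ∩ non-split restriction used by `stub_zhangFrameHL_nonsplit_of_regulatorNonvanishing_onA1` (case split on `3 ∣ ∏c`).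
Nothing asserted about Schneider's conjecture. [folklore] -/
theorem schneiderAtThree_iff_tam_and_onA1 :
    Summit.BirchSwinnertonDyer.BirchSwinnertonDyer.Theses.ClassRecordThree.SchneiderAtThree ↔
      (Summit.BirchSwinnertonDyer.BirchSwinnertonDyer.Theses.KolyvaginRoadThree.SchneiderTamAtThree ∧
        ∀ (W : WeierstrassCurve ℚ) [W.IsElliptic] [W.IsGloballyMinimal],
          Summit.BirchSwinnertonDyer.Rank1Residual.ClassX11b W 3 → Literature.NumberTheory.EllipticCurves.Rank1Residual.Ram W 3 →
            ¬ W.HasSplitMultiplicativeReductionAtPrime 3 → ¬ 3 ∣ W.tamagawaProduct →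
            ClassClosure.RegulatorNonvanishingAt W 3) := by
  constructor
  · intro h
    exact ⟨fun W _ _ hX hram hns _ ↦ h W hX hram hns, fun W _ _ hX hram hns _ ↦ h W hX hram hns⟩
  · rintro ⟨hT, hA⟩ W _ _ hX hram hns
    by_cases ht : 3 ∣ W.tamagawaProduct
    · exact hT W hX hram hns ht
    · exact hA W hX hram hns ht

end Summit.BirchSwinnertonDyer.BirchSwinnertonDyer.Theorems

end
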